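import Summits.NavierStokesRegularity.OSWSelfSimilar.SheetRFarFieldT2
import Summits.NavierStokesRegularity.OSWSelfSimilar.SheetRGudermannianSeries
import HarnessLib

/-!
# SHEET-ℝ frame: `𝒰T₂` and `H T₂` as trigonometric series in the Cayley angle, with exact tails

HONEST FRAMING (cell ns-blowup GROUP B / zone Z3, case Z3-SR-CERT; 1-D MODEL certificate frame; not Euler/NS).

Corollaries AT `ξ = L·tan(θ/2)`, `θ ∈ (−π, π)`, `L > 0`, of the closed forms of `SheetRFarFieldT2` and the series of
`SheetRGudermannianSeries` — the form in which the interval stages (cert-1 PRICE-impl1 §4 T1, cert-2 impl-2 plan) consume the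
far-field shape `T₂(y) = y·((L² + y²)√(L² + y²))⁻¹` (PRICE's `T₂` is `L²`× this one):

* `L²·𝒰T₂(L tan(θ/2)) = −(2L/π)·cos(θ/2)·arsinh(tan(θ/2)) = −(4L/π)·Σ_{n≥0} (−1)ⁿ sin((n+1)θ)/((2n+1)(2n+3))`
  (`= −(4L/π)Σ_{j≥1}(−1)^{j−1} sin jθ/(4j²−1)`), truncation error after `K` terms `≤ 2L/(π(2K+1))`;
* `L²·H T₂(L tan(θ/2)) = π⁻¹·[sin θ · cos(θ/2)·arsinh(tan(θ/2)) − (1 + cos θ)]`, so that with the same sine series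
  `L²·H T₂ + π⁻¹(1 + cos θ) = π⁻¹ Σ_{n≥0} (−1)ⁿ·2/((2n+1)(2n+3))·(sin θ·sin((n+1)θ))`, an integer-frequency cosine series after
  `sin θ·sin((n+1)θ) = ½(cos nθ − cos((n+2)θ))` (recorded termwise), truncation error `≤ |sin θ|/(π(2K+1))`.

`𝒰 = Literature.Analysis.FluidPDE.lineVelocity`, `H = Literature.Analysis.Fourier.hilbertTransform`. Pure bookkeeping on explicit
functions; no definition, no named fact, nothing asserted about any profile. MODEL frame bookkeeping only.
-/

noncomputable section

namespace Summit.NavierStokesRegularity.OSWSelfSimilar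
namespace SheetRFarFieldT2Series

open _root_.Real _root_.Set _root_.Finset
open scoped Real
open Literature.Analysis.Fourier
open SheetRFarFieldT2 SheetRGudermannianSeries

/-! ### §1 The substitution `ξ = L tan(θ/2)` -/

/-- `arctan((L tan(θ/2))/L) = θ/2` for `θ ∈ (−π, π)`, `L ≠ 0`. [folklore] -/
theorem arctan_cayley_div {L : ℝ} (hL : L ≠ 0) {θ : ℝ} (hθ : θ ∈ Ioo (-π) π) :
    Real.arctan (L * Real.tan (θ / 2) / L) = θ / 2 := by
  rw [mul_div_cancel_left₀ _ hL]
  exact Real.arctan_tan (by linarith [hθ.1]) (by linarith [hθ.2])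

/-! ### §2 The velocity `𝒰T₂` as a sine series -/

/-- **`L²·𝒰T₂(L tan(θ/2)) = −(2L/π)·cos(θ/2)·arsinh(tan(θ/2))`** (`θ ∈ (−π, π)`, `L > 0`). [folklore] -/
theorem lineVelocity_farFieldT2_halfAngle {L : ℝ} (hL : 0 < L) {θ : ℝ} (hθ : θ ∈ Ioo (-π) π) :
    L ^ 2 * Literature.Analysis.FluidPDE.lineVelocity
        (fun y : ℝ => y / ((L ^ 2 + y ^ 2) * √(L ^ 2 + y ^ 2))) (L * Real.tan (θ / 2)) =
      -(2 * L / π) * Real.cos (θ / 2) * Real.arsinh (Real.tan (θ / 2)) := by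
  rw [lineVelocity_farFieldT2_cayley hL, arctan_cayley_div hL.ne' hθ, mul_div_cancel_left₀ _ hL.ne']

/-- **The engines' series for the velocity of the far-field shape**:
`L²·𝒰T₂(L tan(θ/2)) = −(4L/π)·Σ_{n≥0} (−1)ⁿ·sin((n+1)θ)/((2n+1)(2n+3))` (`θ ∈ (−π, π)`, `L > 0`;
PRICE-impl1 §4 T1 «𝒰T₂ = −(4L/π)Σ(−1)^{j−1} sin jθ/(4j²−1)»). [folklore] -/
theorem hasSum_lineVelocity_farFieldT2 {L : ℝ} (hL : 0 < L) {θ : ℝ} (hθ : θ ∈ Ioo (-π) π) :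
    HasSum (fun n : ℕ => -(4 * L / π) * ((-1 : ℝ) ^ n / ((2 * n + 1) * (2 * n + 3))) * Real.sin ((n + 1) * θ))
      (L ^ 2 * Literature.Analysis.FluidPDE.lineVelocity
        (fun y : ℝ => y / ((L ^ 2 + y ^ 2) * √(L ^ 2 + y ^ 2))) (L * Real.tan (θ / 2))) := by
  rw [lineVelocity_farFieldT2_halfAngle hL hθ,
    show -(2 * L / π) * Real.cos (θ / 2) * Real.arsinh (Real.tan (θ / 2)) =
      -(2 * L / π) * (Real.cos (θ / 2) * Real.arsinh (Real.tan (θ / 2))) by ring]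
  have h := (hasSum_sin_series_cos_half_mul_arsinh_tan_half hθ).mul_left (-(2 * L / π))
  refine h.congr_fun fun n => ?_
  ring

/-- **Truncation error**: `|L²·𝒰T₂(L tan(θ/2)) − (−(4L/π))·Σ_{n<K} (−1)ⁿ sin((n+1)θ)/((2n+1)(2n+3))| ≤ 2L/(π(2K+1))`
(cert-2 impl-2 plan: «Σ_{j>K}|u_j| = 2L/(π(2K+1)) exact»). [folklore] -/
theorem abs_lineVelocity_farFieldT2_sub_sum_le {L : ℝ} (hL : 0 < L) {θ : ℝ} (hθ : θ ∈ Ioo (-π) π) (K : ℕ) :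
    |L ^ 2 * Literature.Analysis.FluidPDE.lineVelocity
          (fun y : ℝ => y / ((L ^ 2 + y ^ 2) * √(L ^ 2 + y ^ 2))) (L * Real.tan (θ / 2)) -
        ∑ n ∈ range K, -(4 * L / π) * ((-1 : ℝ) ^ n / ((2 * n + 1) * (2 * n + 3))) * Real.sin ((n + 1) * θ)| ≤
      2 * L / (π * (2 * K + 1)) := by
  rw [lineVelocity_farFieldT2_halfAngle hL hθ]
  have hsum : ∑ n ∈ range K, -(4 * L / π) * ((-1 : ℝ) ^ n / ((2 * n + 1) * (2 * n + 3))) * Real.sin ((n + 1) * θ) =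
      -(2 * L / π) * ∑ n ∈ range K, (-1 : ℝ) ^ n * 2 / ((2 * n + 1) * (2 * n + 3)) * Real.sin ((n + 1) * θ) := by
    rw [mul_sum]
    refine sum_congr rfl fun n _ => ?_
    ring
  rw [hsum, show -(2 * L / π) * Real.cos (θ / 2) * Real.arsinh (Real.tan (θ / 2)) -
      -(2 * L / π) * ∑ n ∈ range K, (-1 : ℝ) ^ n * 2 / ((2 * n + 1) * (2 * n + 3)) * Real.sin ((n + 1) * θ) =
      -(2 * L / π) * (Real.cos (θ / 2) * Real.arsinh (Real.tan (θ / 2)) -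
        ∑ n ∈ range K, (-1 : ℝ) ^ n * 2 / ((2 * n + 1) * (2 * n + 3)) * Real.sin ((n + 1) * θ)) by ring,
    abs_mul, abs_neg, abs_of_pos (by positivity : (0:ℝ) < 2 * L / π)]
  have h := abs_cos_half_mul_arsinh_tan_half_sub_sum_le hθ K
  calc 2 * L / π * |Real.cos (θ / 2) * Real.arsinh (Real.tan (θ / 2)) -
          ∑ n ∈ range K, (-1 : ℝ) ^ n * 2 / ((2 * n + 1) * (2 * n + 3)) * Real.sin ((n + 1) * θ)|
      ≤ 2 * L / π * (1 / (2 * K + 1)) := mul_le_mul_of_nonneg_left h (by positivity)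
    _ = 2 * L / (π * (2 * K + 1)) := by
      field_simp

/-! ### §3 `H T₂` in the Cayley angle -/

/-- **`L²·H T₂(L tan(θ/2)) = π⁻¹·[sin θ·cos(θ/2)·arsinh(tan(θ/2)) − (1 + cos θ)]`** (`θ ∈ (−π, π)`, `L > 0`): PRICE-impl1 T1's
`(1 + cos θ)π⁻¹[sin(θ/2)gd⁻¹(θ/2) − 1]` with `(1 + cos θ)·sin(θ/2) = sin θ·cos(θ/2)`, so that the logarithmic factor only enters
through the series-carrying product `cos(θ/2)·gd⁻¹(θ/2)`. [folklore] -/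
theorem hilbertTransform_farFieldT2_halfAngle {L : ℝ} (hL : 0 < L) {θ : ℝ} (hθ : θ ∈ Ioo (-π) π) :
    L ^ 2 * hilbertTransform (fun y : ℝ => y / ((L ^ 2 + y ^ 2) * √(L ^ 2 + y ^ 2))) (L * Real.tan (θ / 2)) =
      π⁻¹ * (Real.sin θ * (Real.cos (θ / 2) * Real.arsinh (Real.tan (θ / 2))) - (1 + Real.cos θ)) := by
  rw [hilbertTransform_farFieldT2_cayley hL, arctan_cayley_div hL.ne' hθ, mul_div_cancel_left₀ _ hL.ne',
    show (2 : ℝ) * (θ / 2) = θ by ring]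
  -- `1 + cos θ = 2cos²(θ/2)`, `sin θ = 2 sin(θ/2) cos(θ/2)`
  have hc : Real.cos θ = 2 * Real.cos (θ / 2) ^ 2 - 1 := by
    rw [Real.cos_sq, show (2 : ℝ) * (θ / 2) = θ by ring]; ring
  have hs : Real.sin θ = 2 * Real.sin (θ / 2) * Real.cos (θ / 2) := by
    rw [← Real.sin_two_mul]; ring_nf
  rw [hc, hs]
  ring

/-- **The product series for `H T₂`**: `L²·H T₂(L tan(θ/2)) + π⁻¹(1 + cos θ) = π⁻¹·Σ_{n≥0} (−1)ⁿ·2/((2n+1)(2n+3))·(sin θ·sin((n+1)θ))`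
(`θ ∈ (−π, π)`, `L > 0`). [folklore] -/
theorem hasSum_hilbertTransform_farFieldT2 {L : ℝ} (hL : 0 < L) {θ : ℝ} (hθ : θ ∈ Ioo (-π) π) :
    HasSum (fun n : ℕ => π⁻¹ * ((-1 : ℝ) ^ n * 2 / ((2 * n + 1) * (2 * n + 3))) * (Real.sin θ * Real.sin ((n + 1) * θ)))
      (L ^ 2 * hilbertTransform (fun y : ℝ => y / ((L ^ 2 + y ^ 2) * √(L ^ 2 + y ^ 2))) (L * Real.tan (θ / 2)) +
        π⁻¹ * (1 + Real.cos θ)) := by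
  rw [hilbertTransform_farFieldT2_halfAngle hL hθ]
  have h := (hasSum_sin_series_cos_half_mul_arsinh_tan_half hθ).mul_left (π⁻¹ * Real.sin θ)
  have hval : π⁻¹ * Real.sin θ * (Real.cos (θ / 2) * Real.arsinh (Real.tan (θ / 2))) =
      π⁻¹ * (Real.sin θ * (Real.cos (θ / 2) * Real.arsinh (Real.tan (θ / 2))) - (1 + Real.cos θ)) +
        π⁻¹ * (1 + Real.cos θ) := by ring
  rw [hval] at h
  refine h.congr_fun fun n => ?_
  ring

/-- Product-to-sum for the terms: `sin θ·sin((n+1)θ) = ½(cos(nθ) − cos((n+2)θ))` — the series of `H T₂` is an integer-frequency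
COSINE series. [folklore] -/
theorem sin_mul_sin_succ_mul (θ : ℝ) (n : ℕ) :
    Real.sin θ * Real.sin ((n + 1) * θ) = (Real.cos (n * θ) - Real.cos ((n + 2) * θ)) / 2 := by
  rw [Real.cos_sub_cos]
  have h1 : ((n : ℝ) * θ + (n + 2) * θ) / 2 = (n + 1) * θ := by ring
  have h2 : ((n : ℝ) * θ - (n + 2) * θ) / 2 = -θ := by ring
  rw [h1, h2, Real.sin_neg]
  ring

/-- **Truncation error for `H T₂`**: `|L²·H T₂(L tan(θ/2)) + π⁻¹(1 + cos θ) − π⁻¹ Σ_{n<K} a_n·(sin θ·sin((n+1)θ))| ≤ |sin θ|/(π(2K+1))`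
(`≤ 1/(π(2K+1))`). [folklore] -/
theorem abs_hilbertTransform_farFieldT2_sub_sum_le {L : ℝ} (hL : 0 < L) {θ : ℝ} (hθ : θ ∈ Ioo (-π) π) (K : ℕ) :
    |L ^ 2 * hilbertTransform (fun y : ℝ => y / ((L ^ 2 + y ^ 2) * √(L ^ 2 + y ^ 2))) (L * Real.tan (θ / 2)) +
          π⁻¹ * (1 + Real.cos θ) -
        ∑ n ∈ range K, π⁻¹ * ((-1 : ℝ) ^ n * 2 / ((2 * n + 1) * (2 * n + 3))) * (Real.sin θ * Real.sin ((n + 1) * θ))| ≤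
      |Real.sin θ| / (π * (2 * K + 1)) := by
  rw [hilbertTransform_farFieldT2_halfAngle hL hθ]
  have hsum : ∑ n ∈ range K, π⁻¹ * ((-1 : ℝ) ^ n * 2 / ((2 * n + 1) * (2 * n + 3))) * (Real.sin θ * Real.sin ((n + 1) * θ)) =
      π⁻¹ * Real.sin θ * ∑ n ∈ range K, (-1 : ℝ) ^ n * 2 / ((2 * n + 1) * (2 * n + 3)) * Real.sin ((n + 1) * θ) := by
    rw [mul_sum]
    refine sum_congr rfl fun n _ => ?_
    ring
  rw [hsum, show π⁻¹ * (Real.sin θ * (Real.cos (θ / 2) * Real.arsinh (Real.tan (θ / 2))) - (1 + Real.cos θ)) +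
      π⁻¹ * (1 + Real.cos θ) -
      π⁻¹ * Real.sin θ * ∑ n ∈ range K, (-1 : ℝ) ^ n * 2 / ((2 * n + 1) * (2 * n + 3)) * Real.sin ((n + 1) * θ) =
      π⁻¹ * Real.sin θ * (Real.cos (θ / 2) * Real.arsinh (Real.tan (θ / 2)) -
        ∑ n ∈ range K, (-1 : ℝ) ^ n * 2 / ((2 * n + 1) * (2 * n + 3)) * Real.sin ((n + 1) * θ)) by ring,
    abs_mul, abs_mul, abs_of_pos (by positivity : (0:ℝ) < π⁻¹)]
  have h := abs_cos_half_mul_arsinh_tan_half_sub_sum_le hθ K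
  calc π⁻¹ * |Real.sin θ| * |Real.cos (θ / 2) * Real.arsinh (Real.tan (θ / 2)) -
          ∑ n ∈ range K, (-1 : ℝ) ^ n * 2 / ((2 * n + 1) * (2 * n + 3)) * Real.sin ((n + 1) * θ)|
      ≤ π⁻¹ * |Real.sin θ| * (1 / (2 * K + 1)) := mul_le_mul_of_nonneg_left h (by positivity)
    _ = |Real.sin θ| / (π * (2 * K + 1)) := by
      field_simp

end SheetRFarFieldT2Series
end Summit.NavierStokesRegularity.OSWSelfSimilar
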